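import Summits.RiemannHypothesis.RiemannHypothesis.Theorems.JensenLogBandArcDescentDeriv
import Summits.RiemannHypothesis.RiemannHypothesis.Theorems.JensenLogBandArcDescent
import Summits.RiemannHypothesis.RiemannHypothesis.Theorems.JensenLogBandDescentCompare
import Mathlib.Analysis.SpecialFunctions.Trigonometric.Bounds
import HarnessLib

/-!
# Global descent of the `ζ`-free arc integrand off the saddle (BAND line, step S4c)

RH ladder column JENSEN, rung J-P(P3) «log band», BAND crux `XiDerivBandRealAllRates` of route
«JensenLogBand», line «band-one-window» (u-arc reshape), lead rh-jensen-prover g7 — step (S4c)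
of HOME/rh-jensen-prover/g7-work/LINE-PLAN.md §8.2, assembled from `descent_deriv_estimate`
(p489793), eng-2 g5's `hasDerivAt_log_norm_arcModelIntegrand` (p487066) and cosine-descent
comparison `sub_le_neg_mul_one_sub_cos_right/left` (p487992). RH-FREE (Γ-factor only). WHAT THIS
IS NOT: nothing here bears on zeros of `ζ` or the truth of RH.

**Result (`log_norm_arcModelIntegrand_descent`).** In the regime `|x| ≤ ½`, `T ≥ 100`,
`ℓ_T ≥ 400`, `n ≥ 100`, `½ ≤ h(n,T) ≤ (7/20)T` (free by `band_regime`), for a zero `u*` of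
`S_{n,c}` in the disc (`c = x+iT`, `r = ‖u*−c‖`, `φ₀ = arg(u*−c)`) and every angle `φ` with
`|φ| < π/2`, `|φ − φ₀| ≤ π/2`:

  `log ‖I(φ)‖ − log ‖I(φ₀)‖ ≤ −(17/20)·n·(1 − cos(φ − φ₀))`,  `I = arcModelIntegrand n r c`.

(`(π/2)·M r² ≤ (3/20)·n` for `ℓ_T ≥ 400` — `norm_mul_sq_le_of_ell_ge`.) The leftover flank
`φ ∈ (φ₀ + π/2, π/2)` (only when `φ₀ < 0`) is monotone by `descent_deriv_neg_of_angle_ge`.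
-/

noncomputable section

-- single-problem summit: `Summit.RiemannHypothesis.RiemannHypothesis.…` is the tree convention
set_option linter.dupNamespace false

open Complex Real Set

namespace Summit.RiemannHypothesis.RiemannHypothesis.Theorems.JensenPolynomials.LogBandArc

open Literature.NumberTheory.LFunctions

variable {n : ℕ} {x T : ℝ} {ustar : ℂ}

/-- **The error constant is small for `ℓ_T ≥ 400`:** `(π/2)·M·r² ≤ (3/20)·n` where
`M = 11.21/T + 1/(0.58T)² + (n+1)/(1.58T)²` and `r = ‖u* − c‖ ≤ (20/9)(n/ℓ_T)`. [folklore] -/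
theorem norm_mul_sq_le_of_ell_ge (hT : 100 ≤ T) (hℓ : 400 ≤ ell T) (hn : 100 ≤ n)
    (hhT : bandRadius n T ≤ 7 / 20 * T) {r : ℝ} (hr0 : 0 ≤ r)
    (hr : r ≤ 20 / 9 * ((n : ℝ) / ell T)) :
    Real.pi / 2 * ((1121 / 100 / T + 1 / (29 / 50 * T) ^ 2 + ((n : ℝ) + 1) / (79 / 50 * T) ^ 2) *
      r ^ 2) ≤ 3 / 20 * n := by
  set h := bandRadius n T with hhdef
  set ℓ := ell T with hℓdef
  have hT0 : 0 < T := by linarith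
  have hℓ0 : 0 < ℓ := by linarith
  have hhℓ : h * ℓ = 2 * ((n : ℝ) + 1) := bandRadius_mul_ell (by linarith)
  have hnpos : (0 : ℝ) < n := by exact_mod_cast (show 0 < n by omega)
  have hnℓ : (n : ℝ) / ℓ ≤ h / 2 := by
    rw [div_le_iff₀ hℓ0]; nlinarith only [hhℓ, hℓ0]
  have hrh : r ≤ 10 / 9 * h := by linarith
  have hh0 : 0 < h := by nlinarith only [hhℓ, hℓ0, hnpos, hℓ]
  have hr2 : r ^ 2 ≤ (10 / 9 * h) ^ 2 := pow_le_pow_left₀ hr0 hrh 2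
  set t := h / T with ht
  have hht : h = t * T := by rw [ht]; field_simp
  have ht0 : 0 ≤ t := by positivity
  have ht1 : t ≤ 7 / 20 := by rw [ht, div_le_iff₀ hT0]; linarith
  have hh400 : h ≤ ((n : ℝ) + 1) / 200 := by
    have : 400 * h ≤ h * ℓ := by nlinarith only [hh0, hℓ]
    linarith
  have k1 : 1121 / 100 / T * (10 / 9 * h) ^ 2 ≤ 243 / 10000 * ((n : ℝ) + 1) := by
    have e1 : 1121 / 100 / T * (10 / 9 * h) ^ 2 = 112100 / 8100 * t * h := by
      rw [hht]; field_simp; ring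
    rw [e1]
    have : t * h ≤ 7 / 20 * h := mul_le_mul_of_nonneg_right ht1 hh0.le
    linarith
  have k2 : 1 / (29 / 50 * T) ^ 2 * (10 / 9 * h) ^ 2 ≤ 45 / 10000 * ((n : ℝ) + 1) := by
    have e1 : 1 / (29 / 50 * T) ^ 2 * (10 / 9 * h) ^ 2 = 250000 / 68121 * t ^ 2 := by
      rw [hht]; field_simp; ring
    rw [e1]
    have : t ^ 2 ≤ (7 / 20) ^ 2 := pow_le_pow_left₀ ht0 ht1 2
    have hn1 : (101 : ℝ) ≤ (n : ℝ) + 1 := by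
      have : (100 : ℝ) ≤ n := by exact_mod_cast hn
      linarith
    linarith
  have k3 : ((n : ℝ) + 1) / (79 / 50 * T) ^ 2 * (10 / 9 * h) ^ 2 ≤ 607 / 10000 * ((n : ℝ) + 1) := by
    have e1 : ((n : ℝ) + 1) / (79 / 50 * T) ^ 2 * (10 / 9 * h) ^ 2 =
        250000 / 505521 * t ^ 2 * ((n : ℝ) + 1) := by
      rw [hht]; field_simp; ring
    rw [e1]
    have ht2 : t ^ 2 ≤ (7 / 20) ^ 2 := pow_le_pow_left₀ ht0 ht1 2
    have hn0 : (0 : ℝ) ≤ (n : ℝ) + 1 := by positivity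
    have := mul_le_mul_of_nonneg_right ht2 hn0
    linarith
  have hM0 : 0 ≤ 1121 / 100 / T + 1 / (29 / 50 * T) ^ 2 + ((n : ℝ) + 1) / (79 / 50 * T) ^ 2 := by
    positivity
  have hsum : (1121 / 100 / T + 1 / (29 / 50 * T) ^ 2 + ((n : ℝ) + 1) / (79 / 50 * T) ^ 2) * r ^ 2
      ≤ 895 / 10000 * ((n : ℝ) + 1) := by
    calc (1121 / 100 / T + 1 / (29 / 50 * T) ^ 2 + ((n : ℝ) + 1) / (79 / 50 * T) ^ 2) * r ^ 2
        ≤ (1121 / 100 / T + 1 / (29 / 50 * T) ^ 2 + ((n : ℝ) + 1) / (79 / 50 * T) ^ 2) *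
            (10 / 9 * h) ^ 2 := mul_le_mul_of_nonneg_left hr2 hM0
      _ = 1121 / 100 / T * (10 / 9 * h) ^ 2 + 1 / (29 / 50 * T) ^ 2 * (10 / 9 * h) ^ 2 +
            ((n : ℝ) + 1) / (79 / 50 * T) ^ 2 * (10 / 9 * h) ^ 2 := by ring
      _ ≤ 895 / 10000 * ((n : ℝ) + 1) := by linarith
  have hn' : (100 : ℝ) ≤ n := by exact_mod_cast hn
  nlinarith [Real.pi_lt_d2, Real.pi_pos, hsum]

/-- Side conditions on the open right half-arc `u = c + r e^{it}`, `|t| < π/2`, `0 < r ≤ (21/50)T`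
(`c = x + iT`, `|x| ≤ ½`, `T ≥ 100`): `Re(½+u) > 0`, `½ + u ≠ 1`, `u ≠ 0`, `u + c ≠ 0`. [folklore] -/
theorem arc_side_conditions (hx : |x| ≤ 1 / 2) (hT : 100 ≤ T) {r : ℝ} (hr0 : 0 < r)
    (hrT : r ≤ 21 / 50 * T) {t : ℝ} (ht : |t| < Real.pi / 2) :
    0 < (1 / 2 + circleMap ((x : ℂ) + (T : ℂ) * I) r t).re ∧
      1 / 2 + circleMap ((x : ℂ) + (T : ℂ) * I) r t ≠ 1 ∧
      circleMap ((x : ℂ) + (T : ℂ) * I) r t ≠ 0 ∧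
      circleMap ((x : ℂ) + (T : ℂ) * I) r t + ((x : ℂ) + (T : ℂ) * I) ≠ 0 := by
  set c : ℂ := (x : ℂ) + (T : ℂ) * I with hc
  have hx' := abs_le.1 hx
  obtain ⟨hre_t, him_t⟩ := circleMap_sub_re_im c r t
  have ht' := abs_lt.1 ht
  have hcos : 0 < Real.cos t := Real.cos_pos_of_mem_Ioo ⟨by linarith [ht'.1], ht'.2⟩
  have hsin : -1 ≤ Real.sin t := Real.neg_one_le_sin t
  have hcre : c.re = x := by simp [hc]
  have hcim : c.im = T := by simp [hc]
  have hure : (circleMap c r t).re = x + r * Real.cos t := by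
    have : (circleMap c r t).re = (circleMap c r t - c).re + c.re := by
      rw [Complex.sub_re]; ring
    rw [this, hre_t, hcre]; ring
  have huim : (circleMap c r t).im = T + r * Real.sin t := by
    have : (circleMap c r t).im = (circleMap c r t - c).im + c.im := by
      rw [Complex.sub_im]; ring
    rw [this, him_t, hcim]; ring
  have hrs : -r ≤ r * Real.sin t := by nlinarith
  have him_pos : 0 < (circleMap c r t).im := by rw [huim]; linarith
  have hrc : 0 < r * Real.cos t := mul_pos hr0 hcos
  refine ⟨?_, ?_, ?_, ?_⟩
  · have : (1 / 2 + circleMap c r t).re = 1 / 2 + (x + r * Real.cos t) := by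
      rw [Complex.add_re, hure]; norm_num
    rw [this]; linarith
  · intro h0; have := congrArg Complex.im h0; simp at this; linarith
  · intro h0; rw [h0] at him_pos; simp at him_pos
  · intro h0
    have := congrArg Complex.im h0
    rw [Complex.add_im, huim, hcim, Complex.zero_im] at this
    linarith

/-- Jordan's inequality in the form used for absorbing the error: for `0 ≤ s ≤ π/2` and `K ≥ 0`,
`K·s ≤ (π/2)·K·sin s`. [folklore] -/
theorem mul_le_half_pi_mul_sin {K s : ℝ} (hK : 0 ≤ K) (hs0 : 0 ≤ s) (hs1 : s ≤ Real.pi / 2) :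
    K * s ≤ Real.pi / 2 * K * Real.sin s := by
  have hπ2 : 0 < Real.pi / 2 := by positivity
  have hjordan : 2 / Real.pi * s ≤ Real.sin s := Real.mul_le_sin hs0 hs1
  have h2 : s ≤ Real.pi / 2 * Real.sin s := by
    calc s = Real.pi / 2 * (2 / Real.pi * s) := by field_simp
      _ ≤ Real.pi / 2 * Real.sin s := mul_le_mul_of_nonneg_left hjordan hπ2.le
  calc K * s ≤ K * (Real.pi / 2 * Real.sin s) := mul_le_mul_of_nonneg_left h2 hK
    _ = Real.pi / 2 * K * Real.sin s := by ring

/-- **Global descent off the saddle (S4c).** See the module docstring. [folklore] -/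
theorem log_norm_arcModelIntegrand_descent (hx : |x| ≤ 1 / 2) (hT : 100 ≤ T)
    (hℓ : 400 ≤ ell T) (hn : 100 ≤ n) (hh : 1 / 2 ≤ bandRadius n T)
    (hhT : bandRadius n T ≤ 7 / 20 * T)
    (hustar : ‖ustar - ((x : ℂ) + (T : ℂ) * I + bandRadius n T)‖ ≤ 3 / 5 * bandRadius n T)
    (hS : arcSaddleFn n ((x : ℂ) + (T : ℂ) * I) ustar = 0) {φ : ℝ} (hφ : |φ| < Real.pi / 2)
    (hφ₀ : |φ - Complex.arg (ustar - ((x : ℂ) + (T : ℂ) * I))| ≤ Real.pi / 2) :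
    Real.log ‖arcModelIntegrand n ‖ustar - ((x : ℂ) + (T : ℂ) * I)‖ ((x : ℂ) + (T : ℂ) * I) φ‖ -
      Real.log ‖arcModelIntegrand n ‖ustar - ((x : ℂ) + (T : ℂ) * I)‖ ((x : ℂ) + (T : ℂ) * I)
        (Complex.arg (ustar - ((x : ℂ) + (T : ℂ) * I)))‖ ≤
      -(17 / 20 * n) * (1 - Real.cos (φ - Complex.arg (ustar - ((x : ℂ) + (T : ℂ) * I)))) := by
  set c : ℂ := (x : ℂ) + (T : ℂ) * I with hc
  set w : ℂ := ustar - c with hw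
  set r : ℝ := ‖w‖ with hr
  set φ₀ : ℝ := Complex.arg w with hφ₀def
  set M : ℝ := 1121 / 100 / T + 1 / (29 / 50 * T) ^ 2 + ((n : ℝ) + 1) / (79 / 50 * T) ^ 2 with hM
  have hℓ20 : 20 ≤ ell T := by linarith
  have hℓ0 : 0 < ell T := by linarith
  have hT0 : 0 < T := by linarith
  obtain ⟨hre_pos, -, -, -, hr_hi⟩ := arcSaddle_polar_bounds hx hT hℓ20 hn hh hhT hustar hS
  have hw0 : w ≠ 0 := by
    intro h0
    have h' : (0 : ℝ) < w.re := hre_pos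
    rw [h0] at h'
    simp at h'
  have hr0 : 0 < r := norm_pos_iff.2 hw0
  have hhℓ : bandRadius n T * ell T = 2 * ((n : ℝ) + 1) := bandRadius_mul_ell hℓ20
  have hrh : r ≤ 6 / 5 * bandRadius n T := by
    have h1 : r ≤ 20 / 9 * ((n : ℝ) / ell T) := hr_hi
    have h2 : (n : ℝ) / ell T ≤ bandRadius n T / 2 := by
      rw [div_le_iff₀ hℓ0]; nlinarith
    linarith
  have hrT : r ≤ 21 / 50 * T := by linarith
  have hφ₀mem : |φ₀| < Real.pi / 2 := Complex.abs_arg_lt_pi_div_two_iff.2 (Or.inl hre_pos)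
  -- the constant
  have hA : Real.pi / 2 * (M * r ^ 2) ≤ 3 / 20 * n :=
    norm_mul_sq_le_of_ell_ge hT hℓ hn hhT hr0.le hr_hi
  set g : ℝ → ℝ := fun θ => Real.log ‖arcModelIntegrand n r c θ‖ with hg
  set g' : ℝ → ℝ := fun θ => (I * (circleMap c r θ - c) * arcSaddleFn n c (circleMap c r θ)).re
    with hg'
  -- side conditions on the open arc
  have hside : ∀ t : ℝ, |t| < Real.pi / 2 →
      0 < (1 / 2 + circleMap c r t).re ∧ 1 / 2 + circleMap c r t ≠ 1 ∧ circleMap c r t ≠ 0 ∧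
        circleMap c r t + c ≠ 0 := fun t ht => arc_side_conditions hx hT hr0 hrT ht
  have hderiv : ∀ t : ℝ, |t| < Real.pi / 2 → HasDerivAt g (g' t) t := by
    intro t ht
    obtain ⟨h1, h2, h3, h4⟩ := hside t ht
    exact hasDerivAt_log_norm_arcModelIntegrand n hr0.ne' c t h1 h2 h3 h4
  have hest : ∀ t : ℝ, |t| < Real.pi / 2 → |g' t + n * Real.sin (t - φ₀)| ≤ M * r ^ 2 * |t - φ₀| := by
    intro t ht
    obtain ⟨h1, h2, -, -⟩ := hside t ht
    have htI : t ∈ Icc (-(Real.pi / 2)) (Real.pi / 2) := ⟨(abs_lt.1 ht).1.le, (abs_lt.1 ht).2.le⟩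
    exact descent_deriv_estimate hx hT hℓ20 hn hh hhT hustar hS htI h1 h2
  -- Jordan: `|s| ≤ (π/2)|sin s|` for `|s| ≤ π/2`, so the error is absorbed: `A = n − (π/2) M r²`
  set A : ℝ := n - Real.pi / 2 * (M * r ^ 2) with hAdef
  have hMr0 : 0 ≤ M * r ^ 2 := by positivity
  have hφabs := abs_lt.1 hφ
  have hφ₀abs := abs_lt.1 hφ₀mem
  have hφφ₀ := abs_le.1 hφ₀
  have hπ2 : 0 < Real.pi / 2 := by positivity
  -- the one-sided derivative bounds
  have hbound : ∀ t : ℝ, |t| < Real.pi / 2 → |t - φ₀| ≤ Real.pi / 2 →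
      (φ₀ ≤ t → g' t ≤ -A * Real.sin (t - φ₀)) ∧ (t ≤ φ₀ → -A * Real.sin (t - φ₀) ≤ g' t) := by
    intro t ht htφ₀
    have h1 := abs_le.1 (hest t ht)
    constructor
    · intro hle
      have hs0 : 0 ≤ t - φ₀ := by linarith only [hle]
      have hs1 : t - φ₀ ≤ Real.pi / 2 := (le_abs_self _).trans htφ₀
      have habs : |t - φ₀| = t - φ₀ := abs_of_nonneg hs0
      rw [habs] at h1
      have h3 := mul_le_half_pi_mul_sin hMr0 hs0 hs1
      rw [hAdef]
      linarith only [h1.2, h3]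
    · intro hle
      have hs0 : 0 ≤ φ₀ - t := by linarith only [hle]
      have hs1 : φ₀ - t ≤ Real.pi / 2 := by
        rw [abs_sub_comm] at htφ₀
        exact (le_abs_self _).trans htφ₀
      have habs : |t - φ₀| = φ₀ - t := by rw [abs_sub_comm]; exact abs_of_nonneg hs0
      rw [habs] at h1
      have hsin : Real.sin (t - φ₀) = -Real.sin (φ₀ - t) := by
        rw [← Real.sin_neg]; ring_nf
      have h3 := mul_le_half_pi_mul_sin hMr0 hs0 hs1
      rw [hsin] at h1
      rw [hAdef, hsin]
      linarith only [h1.1, h3]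
  have key : g φ - g φ₀ ≤ -A * (1 - Real.cos (φ - φ₀)) := by
    rcases le_total φ₀ φ with hle | hle
    · -- right side: t ∈ [φ₀, φ]
      have hmem : ∀ t ∈ Icc φ₀ φ, |t| < Real.pi / 2 ∧ |t - φ₀| ≤ Real.pi / 2 := by
        intro t ht
        exact ⟨abs_lt.2 ⟨by linarith only [ht.1, hφ₀abs.1], by linarith only [ht.2, hφabs.2]⟩,
          abs_le.2 ⟨by linarith only [ht.1, hπ2], by linarith only [ht.2, hφφ₀.2]⟩⟩
      have hgR : ∀ t ∈ Icc φ₀ φ, HasDerivAt g (g' t) t := fun t ht => hderiv t (hmem t ht).1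
      have hbR : ∀ t ∈ Icc φ₀ φ, g' t ≤ -A * Real.sin (t - φ₀) := fun t ht =>
        (hbound t (hmem t ht).1 (hmem t ht).2).1 ht.1
      exact sub_le_neg_mul_one_sub_cos_right hgR hbR ⟨hle, le_rfl⟩
    · -- left side: t ∈ [φ, φ₀]
      have hmem : ∀ t ∈ Icc φ φ₀, |t| < Real.pi / 2 ∧ |t - φ₀| ≤ Real.pi / 2 := by
        intro t ht
        exact ⟨abs_lt.2 ⟨by linarith only [ht.1, hφabs.1], by linarith only [ht.2, hφ₀abs.2]⟩,
          abs_le.2 ⟨by linarith only [ht.1, hφφ₀.1], by linarith only [ht.2, hπ2]⟩⟩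
      have hgL : ∀ t ∈ Icc φ φ₀, HasDerivAt g (g' t) t := fun t ht => hderiv t (hmem t ht).1
      have hbL : ∀ t ∈ Icc φ φ₀, -A * Real.sin (t - φ₀) ≤ g' t := fun t ht =>
        (hbound t (hmem t ht).1 (hmem t ht).2).2 ht.2
      exact sub_le_neg_mul_one_sub_cos_left hgL hbL ⟨le_rfl, hle⟩
  -- `A ≥ (17/20) n` and `1 − cos ≥ 0`
  have hcos : 0 ≤ 1 - Real.cos (φ - φ₀) := by linarith only [Real.cos_le_one (φ - φ₀)]
  have hA' : 17 / 20 * (n : ℝ) ≤ A := by rw [hAdef]; linarith only [hA]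
  have hfin : -A * (1 - Real.cos (φ - φ₀)) ≤ -(17 / 20 * n) * (1 - Real.cos (φ - φ₀)) := by
    have := mul_le_mul_of_nonneg_right hA' hcos
    linarith only [this]
  exact key.trans hfin

end Summit.RiemannHypothesis.RiemannHypothesis.Theorems.JensenPolynomials.LogBandArc

end
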